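import Summits.AnomalousDissipation.AnomalousDissipation.Theorems.SolenoidalFractalHomogenisationLagrangianStepSidebandXResidual
import Summits.AnomalousDissipation.AnomalousDissipation.Theorems.SolenoidalFractalHomogenisationLagrangianStepSidebandXDefectD1
import Summits.AnomalousDissipation.AnomalousDissipation.Theorems.SolenoidalFractalHomogenisationLagrangianStepSidebandXDefectSmall
import Summits.AnomalousDissipation.AnomalousDissipation.Theorems.SolenoidalFractalHomogenisationLagrangianStepSidebandXTail
import Summits.AnomalousDissipation.AnomalousDissipation.Theorems.SolenoidalFractalHomogenisationLagrangianStepSidebandResponseTransversal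
import Summits.AnomalousDissipation.AnomalousDissipation.Theorems.SolenoidalFractalHomogenisationLagrangianStepSidebandXEnergyDefs
import HarnessLib

/-!
# K1L_D `LagrangianRenormalisationStepDesign` (stmt-AnomalousDissipation-27980), `stub_D1_V0` (V0 = clause (ii) of
# `WCrossing.D1ExactFamily`), brick T4c-3d: THE ENERGY INEQUALITY OF THE RESIDUAL — right derivative of `‖r‖²` is
# `≤ −(π²lo/2)‖r‖² + C·(ξ²‖y‖² + ξ⁴‖x‖² + ξ⁴‖Z‖² + tailEnergy)` with `C = C(W₁, lo, hi, β)` uniform in `n, ℓ, R, t, T`, datum and solution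
# (helper; `--kind proof --supports stmt-AnomalousDissipation-27980 --as helper`)

Summits-side helper file of route `SolenoidalFractalHomogenisation` (prover seat `ad-k1l-cellLawV-w1` g7; 0 sorry, no defs, no named facts).
The TYPED TARGET `todo_residual_energy_ineq` of the crux skeleton `Cruxes/LagrangianRenormalisationStepDesign/Lines/onelevel_V0_energy.lean` (memo
`…/Lines/onelevel-V0-residual.md` §2–§3), assembled from the landed bricks `hasDerivWithinAt_residual` + `two_inner_genX_add_le` (…SidebandXResidual),
`two_real_inner_D1_le` (…DefectD1), `norm_sourceX_sub_projX_source_le` + `norm_slowRHS_le` (…DefectSmall), `norm_responseExt_le`, `two_abs_re_inner_tail_le`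
(…XTail; Young against the dissipation weight `|k_z|² ≥ n²/4`).  Objects (`…SidebandXEnergyDefs`): `y = refState`, `r = residualX`, `tailEnergy`;
`x t = modeRep … ℓ t`, `Z t = sbVec … t`, `ξ = √|ℓ|²/n`.  Main: **`residualX_energy_ineq`**; sizes `abs_xiCoeff_le`, `norm_refState_le`, D2/D3/D4 lemmas,
`norm_sq_le_dissipation`, scalar `defect_bookkeeping`.  NOT a proof of any registered stub, of K1L_D, or of anomalous dissipation; rung F-D1.A0.
-/

set_option linter.dupNamespace false

noncomputable section

namespace Summit.AnomalousDissipation.AnomalousDissipation.Theorems.SolenoidalFractalHomogenisation.LagrangianStep.Sideband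

open Set MeasureTheory Complex UnitAddTorus
open scoped InnerProductSpace
open Literature.Analysis Literature.Analysis.FunctionSpaces Literature.Analysis.FunctionSpaces.Torus
open Literature.Analysis.FluidPDE Literature.Analysis.FluidPDE.Torus Literature.Analysis.FluidPDE.LatticeShear
open Summit.AnomalousDissipation.AnomalousDissipation.Theorems.SolenoidalFractalHomogenisation.LagrangianStep.CellChain
  (modeRep kdot_modeRep norm_transversalProj_le)

variable {k₀ : ℕ}

/-! ## §1 The residual unfolded; `|ξⱼ| ≤ ξ`; a Young split -/

/-- Unfolding `residualX` at a time, fully (the shape of the point value in `…SidebandXResidual.hasDerivWithinAt_residual`).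
[cite: SandersVerhulstMurdock2007, Lemma 5.2.7 (linear case)] -/
theorem residualX_apply_expanded (W₁ : LatticeWord k₀) (n : ℕ) (ℓ : Fin 3 → ℤ) (𝔸 : Torus.Visc4 (Fin 3)) (R : ℕ)
    (F : UnitAddTorus (Fin 3) → EuclideanSpace ℝ (Fin 3)) (w : ℝ → UnitAddTorus (Fin 3) → EuclideanSpace ℝ (Fin 3)) (t : ℝ) :
    residualX W₁ n ℓ 𝔸 R F w t = sbVec W₁ n ((1 / (n : ℝ) ^ 2) • 𝔸) F w ℓ R t -
      projX n ℓ R (∑ j, ((xiCoeff W₁ n ℓ j : ℝ) : ℂ) • responseExt W₁ 𝔸 1 R j t (modeRep W₁ n ((1 / (n : ℝ) ^ 2) • 𝔸) F w ℓ t)) := rfl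

/-- **`|ξⱼ| ≤ ξ = √|ℓ|²/n`** (`‖êⱼ‖ = 1`, Cauchy–Schwarz). [cite: MajdaKramer1999, §2.2.1.3] -/
theorem abs_xiCoeff_le (W₁ : LatticeWord k₀) (n : ℕ) (ℓ : Fin 3 → ℤ) (j : Fin k₀) :
    |xiCoeff W₁ n ℓ j| ≤ Real.sqrt (freqNormSq ℓ) / n := by
  have h := norm_sum_e_mul_le (W₁.phase j) ℓ
  have hcast : ∑ a, (((W₁.phase j).e a : ℝ) : ℂ) * ((ℓ a : ℤ) : ℂ) = ((∑ a, (W₁.phase j).e a * (ℓ a : ℝ) : ℝ) : ℂ) := by push_cast; rfl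
  rw [hcast, Complex.norm_real, Real.norm_eq_abs] at h
  rw [xiCoeff_def, abs_div, Nat.abs_cast]
  exact div_le_div_of_nonneg_right h (Nat.cast_nonneg n)

/-- Young: `2xy ≤ θx² + y²/θ` (`θ > 0`). [folklore] -/
theorem two_mul_le_theta_sq_add {x y θ : ℝ} (hθ : 0 < θ) : 2 * (x * y) ≤ θ * x ^ 2 + y ^ 2 / θ := by
  have hsq : 0 ≤ (θ * x - y) ^ 2 / θ := div_nonneg (sq_nonneg _) hθ.le
  have hexp : (θ * x - y) ^ 2 / θ = θ * x ^ 2 - 2 * (x * y) + y ^ 2 / θ := by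
    field_simp; ring
  linarith [hsq, hexp]

/-! ## §2 The reference state: transversality and size -/

/-- **The reference state is `z`-transversal**: `P_z (y t)_z = (y t)_z`. [cite: Temam1984, Ch. III §1.1] -/
theorem transversalProj_refState_apply (W₁ : LatticeWord k₀) {n : ℕ} (ℓ : Fin 3 → ℤ) {𝔸 : Torus.Visc4 (Fin 3)} {lo hi : ℝ}
    (h𝔸 : Torus.NearIso 𝔸 lo hi) (hlo : 0 < lo) (R : ℕ)
    (F : UnitAddTorus (Fin 3) → EuclideanSpace ℝ (Fin 3)) (w : ℝ → UnitAddTorus (Fin 3) → EuclideanSpace ℝ (Fin 3)) (t : ℝ) (z : box R) :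
    transversalProj z.1 (refState W₁ n ℓ 𝔸 R F w t z) = refState W₁ n ℓ 𝔸 R F w t z := by
  rw [refState_def, space_sum_apply, map_sum]
  refine Finset.sum_congr rfl fun j _ => ?_
  rw [PiLp.smul_apply, map_smul, transversalProj_responseExt_apply W₁ h𝔸 hlo one_pos j t _ z]

/-- `projX 1 0 R (y t) = y t`. [cite: Temam1984, Ch. III §1.1] -/
theorem projX_one_zero_refState (W₁ : LatticeWord k₀) {n : ℕ} (ℓ : Fin 3 → ℤ) {𝔸 : Torus.Visc4 (Fin 3)} {lo hi : ℝ}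
    (h𝔸 : Torus.NearIso 𝔸 lo hi) (hlo : 0 < lo) (R : ℕ)
    (F : UnitAddTorus (Fin 3) → EuclideanSpace ℝ (Fin 3)) (w : ℝ → UnitAddTorus (Fin 3) → EuclideanSpace ℝ (Fin 3)) (t : ℝ) :
    projX 1 0 R (refState W₁ n ℓ 𝔸 R F w t) = refState W₁ n ℓ 𝔸 R F w t := by
  apply PiLp.ext
  intro z
  rw [projX_one_zero_apply, transversalProj_refState_apply W₁ ℓ h𝔸 hlo R F w t z]

/-- `‖Σⱼ ξⱼ • Nⱼ t v‖ ≤ ξ·(Σⱼ 8π‖αⱼ‖/min(1, 4π²lo))·‖v‖`. [cite: SandersVerhulstMurdock2007, Lemma 5.2.7 (linear case)] -/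
theorem norm_sum_smul_responseExt_le (W₁ : LatticeWord k₀) (n : ℕ) (ℓ : Fin 3 → ℤ) {𝔸 : Torus.Visc4 (Fin 3)} {lo hi : ℝ}
    (h𝔸 : Torus.NearIso 𝔸 lo hi) (hlo : 0 < lo) (R : ℕ) (t : ℝ) (v : EuclideanSpace ℂ (Fin 3)) :
    ‖∑ j, ((xiCoeff W₁ n ℓ j : ℝ) : ℂ) • responseExt W₁ 𝔸 1 R j t v‖ ≤
      (Real.sqrt (freqNormSq ℓ) / n) * (∑ j, 8 * Real.pi * ‖slotAmp W₁ j‖ / min 1 (4 * Real.pi ^ 2 * lo)) * ‖v‖ := by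
  refine (norm_sum_le _ _).trans ?_
  rw [Finset.mul_sum, Finset.sum_mul]
  refine Finset.sum_le_sum fun j _ => ?_
  rw [norm_smul, Complex.norm_real, Real.norm_eq_abs]
  have h1 := abs_xiCoeff_le W₁ n ℓ j
  have h2 : ‖responseExt W₁ 𝔸 1 R j t v‖ ≤ (8 * Real.pi * ‖slotAmp W₁ j‖ / min 1 (4 * Real.pi ^ 2 * lo)) * ‖v‖ :=
    (ContinuousLinearMap.le_opNorm _ _).trans (mul_le_mul_of_nonneg_right (norm_responseExt_le W₁ h𝔸 hlo one_pos R j t) (norm_nonneg _))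
  have h0 : 0 ≤ 8 * Real.pi * ‖slotAmp W₁ j‖ / min 1 (4 * Real.pi ^ 2 * lo) := by
    have : 0 < min 1 (4 * Real.pi ^ 2 * lo) := lt_min one_pos (by positivity)
    positivity
  calc |xiCoeff W₁ n ℓ j| * ‖responseExt W₁ 𝔸 1 R j t v‖
      ≤ (Real.sqrt (freqNormSq ℓ) / n) * ((8 * Real.pi * ‖slotAmp W₁ j‖ / min 1 (4 * Real.pi ^ 2 * lo)) * ‖v‖) :=
        mul_le_mul h1 h2 (norm_nonneg _) (by positivity)
    _ = _ := by ring

/-- **Size of the reference state**: `‖y t‖ ≤ ξ·(Σⱼ 8π‖αⱼ‖/min(1, 4π²lo))·‖x t‖`. [cite: SandersVerhulstMurdock2007, Lemma 5.2.7 (linear case)] -/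
theorem norm_refState_le (W₁ : LatticeWord k₀) (n : ℕ) (ℓ : Fin 3 → ℤ) {𝔸 : Torus.Visc4 (Fin 3)} {lo hi : ℝ}
    (h𝔸 : Torus.NearIso 𝔸 lo hi) (hlo : 0 < lo) (R : ℕ)
    (F : UnitAddTorus (Fin 3) → EuclideanSpace ℝ (Fin 3)) (w : ℝ → UnitAddTorus (Fin 3) → EuclideanSpace ℝ (Fin 3)) (t : ℝ) :
    ‖refState W₁ n ℓ 𝔸 R F w t‖ ≤
      (Real.sqrt (freqNormSq ℓ) / n) * (∑ j, 8 * Real.pi * ‖slotAmp W₁ j‖ / min 1 (4 * Real.pi ^ 2 * lo)) *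
        ‖modeRep W₁ n ((1 / (n : ℝ) ^ 2) • 𝔸) F w ℓ t‖ :=
  norm_sum_smul_responseExt_le W₁ n ℓ h𝔸 hlo R t _

/-! ## §3 The small groups D2, D3 and the tail D4 summed over the box -/

/-- **D2**: `‖Σⱼ ξⱼ • (sourceXⱼ x − projX (sourceⱼ x))‖ ≤ ξ²·(Σⱼ 4π‖αⱼ‖/√|mⱼ|²)·‖x‖`. [cite: MajdaKramer1999, §2.2.1.3 (cell problem (49), source term)] -/
theorem norm_sum_smul_sourceX_sub_le (W₁ : LatticeWord k₀) {n : ℕ} (hn : n ≠ 0) (ℓ : Fin 3 → ℤ) (R : ℕ) (t : ℝ)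
    (x : EuclideanSpace ℂ (Fin 3)) :
    ‖∑ j, ((xiCoeff W₁ n ℓ j : ℝ) : ℂ) • (sourceX W₁ n ℓ R j t x - projX n ℓ R (source W₁ R j t x))‖ ≤
      (Real.sqrt (freqNormSq ℓ) / n) ^ 2 * (∑ j, 4 * Real.pi * ‖slotAmp W₁ j‖ / Real.sqrt (freqNormSq (W₁.phase j).m)) * ‖x‖ := by
  have hn0 : (0 : ℝ) < n := by exact_mod_cast Nat.pos_of_ne_zero hn
  refine (norm_sum_le _ _).trans ?_
  rw [Finset.mul_sum, Finset.sum_mul]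
  refine Finset.sum_le_sum fun j _ => ?_
  rw [norm_smul, Complex.norm_real, Real.norm_eq_abs]
  have h1 := abs_xiCoeff_le W₁ n ℓ j
  have h2 := norm_sourceX_sub_projX_source_le W₁ hn ℓ (R := R) j t x
  have hM : 0 < Real.sqrt (freqNormSq (W₁.phase j).m) := Real.sqrt_pos.2 (freqNormSq_pos_of_ne_zero' (W₁.phase j).m_ne)
  have hξ : 0 ≤ Real.sqrt (freqNormSq ℓ) / n := by positivity
  calc |xiCoeff W₁ n ℓ j| * ‖sourceX W₁ n ℓ R j t x - projX n ℓ R (source W₁ R j t x)‖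
      ≤ (Real.sqrt (freqNormSq ℓ) / n) *
          (4 * Real.pi * ‖slotAmp W₁ j‖ * (Real.sqrt (freqNormSq ℓ) / (n * Real.sqrt (freqNormSq (W₁.phase j).m))) * ‖x‖) :=
        mul_le_mul h1 h2 (norm_nonneg _) hξ
    _ = _ := by
        field_simp

/-- **D3 (operator part)**: `‖projX (Σⱼ ξⱼ • Nⱼ t v)‖ ≤ ξ·(Σⱼ 8π‖αⱼ‖/min(1,4π²lo))·‖v‖`. [cite: SandersVerhulstMurdock2007, Lemma 5.2.7 (linear case)] -/
theorem norm_projX_sum_smul_responseExt_le (W₁ : LatticeWord k₀) (n : ℕ) (ℓ : Fin 3 → ℤ) {𝔸 : Torus.Visc4 (Fin 3)} {lo hi : ℝ}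
    (h𝔸 : Torus.NearIso 𝔸 lo hi) (hlo : 0 < lo) (R : ℕ) (t : ℝ) (v : EuclideanSpace ℂ (Fin 3)) :
    ‖projX n ℓ R (∑ j, ((xiCoeff W₁ n ℓ j : ℝ) : ℂ) • responseExt W₁ 𝔸 1 R j t v)‖ ≤
      (Real.sqrt (freqNormSq ℓ) / n) * (∑ j, 8 * Real.pi * ‖slotAmp W₁ j‖ / min 1 (4 * Real.pi ^ 2 * lo)) * ‖v‖ :=
  (norm_projX_le n ℓ _).trans (norm_sum_smul_responseExt_le W₁ n ℓ h𝔸 hlo R t v)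

/-- **D3 (the slow rate)**: for `𝔹 = (1/n²)•𝔸`, `x ⊥ ℓ`: `‖ẋ‖ ≤ 4π²(hi+β/2)·ξ²·‖x‖ + ξ·(Σⱼ 4π‖αⱼ‖)·‖Z‖`.
[cite: Frisch1995Turbulence, §9.6.3 eq. (9.57) p. 233] [cite: MajdaKramer1999, §2.2.1.3 (55)] -/
theorem norm_slowRHS_le_xi (W₁ : LatticeWord k₀) {n : ℕ} (hn : n ≠ 0) (ℓ : Fin 3 → ℤ) {𝔸 : Torus.Visc4 (Fin 3)} {lo hi β : ℝ}
    (h𝔸 : Torus.NearIso 𝔸 lo hi) (hlo : 0 < lo) (hhi : 0 ≤ hi) (hodd : Torus.OddSmall 𝔸 β) (hβ : 0 ≤ β) {R : ℕ} (t : ℝ)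
    {x : EuclideanSpace ℂ (Fin 3)} (hx : kdot ℓ x = 0) (Z : Space R) :
    ‖-(((4 * Real.pi ^ 2 : ℝ) : ℂ) • transversalProj ℓ (Torus.symbT (Torus.majorTranspose ((1 / (n : ℝ) ^ 2) • 𝔸)) ℓ x)) -
        ∑ j, ((xiCoeff W₁ n ℓ j : ℝ) : ℂ) • transversalProj ℓ (feedback W₁ R j t Z)‖ ≤
      4 * Real.pi ^ 2 * (hi + β / 2) * (Real.sqrt (freqNormSq ℓ) / n) ^ 2 * ‖x‖ +
        (Real.sqrt (freqNormSq ℓ) / n) * (∑ j, 4 * Real.pi * ‖slotAmp W₁ j‖) * ‖Z‖ := by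
  have hn0 : (0 : ℝ) < n := by exact_mod_cast Nat.pos_of_ne_zero hn
  have hc : (0 : ℝ) ≤ 1 / (n : ℝ) ^ 2 := by positivity
  have h𝔹 : Torus.NearIso ((1 / (n : ℝ) ^ 2) • 𝔸) (1 / (n : ℝ) ^ 2 * lo) (1 / (n : ℝ) ^ 2 * hi) := h𝔸.smul hc
  have hoddB : Torus.OddSmall ((1 / (n : ℝ) ^ 2) • 𝔸) (1 / (n : ℝ) ^ 2 * β) := hodd.smul _
  have h := norm_slowRHS_le W₁ n ℓ h𝔹 (by positivity) (by positivity) hoddB (by positivity) t hx Z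
  have hξ2 : (Real.sqrt (freqNormSq ℓ) / n) ^ 2 = freqNormSq ℓ / (n : ℝ) ^ 2 := by
    rw [div_pow, Real.sq_sqrt (freqNormSq_nonneg ℓ)]
  have e1 : 4 * Real.pi ^ 2 * (1 / (n : ℝ) ^ 2 * hi + 1 / (n : ℝ) ^ 2 * β / 2) * freqNormSq ℓ * ‖x‖ =
      4 * Real.pi ^ 2 * (hi + β / 2) * (Real.sqrt (freqNormSq ℓ) / n) ^ 2 * ‖x‖ := by
    rw [hξ2]; field_simp
  have e2 : (∑ j, |xiCoeff W₁ n ℓ j| * (4 * Real.pi * ‖slotAmp W₁ j‖)) * ‖Z‖ ≤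
      (Real.sqrt (freqNormSq ℓ) / n) * (∑ j, 4 * Real.pi * ‖slotAmp W₁ j‖) * ‖Z‖ := by
    refine mul_le_mul_of_nonneg_right ?_ (norm_nonneg _)
    rw [Finset.mul_sum]
    exact Finset.sum_le_sum fun j _ => mul_le_mul_of_nonneg_right (abs_xiCoeff_le W₁ n ℓ j) (by positivity)
  rw [e1] at h
  linarith

open Classical in
/-- **D4 summed over the box**: `Σ_z 2|Re⟪r_z, (tailVec t)_z⟫| ≤ ¼·𝒟(r) + (2/lo)·tailEnergy t`
(`𝒟(r) = 8π²(lo/n²)Σ_z |k_z|²‖r_z‖²`, Young weight `ε = 2π²lo/n²`; needs `2|ℓ| ≤ n` so that `k_z ≠ 0`).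
[cite: MajdaKramer1999, §2.2.1.3 (cell problem (49))] -/
theorem sum_two_abs_re_inner_tail_le (W₁ : LatticeWord k₀) {n : ℕ} (hn : n ≠ 0) {ℓ : Fin 3 → ℤ} (hℓ : 2 * Real.sqrt (freqNormSq ℓ) ≤ n)
    {lo : ℝ} (hlo : 0 < lo) (𝔸 : Torus.Visc4 (Fin 3)) (R : ℕ)
    (F : UnitAddTorus (Fin 3) → EuclideanSpace ℝ (Fin 3)) (w : ℝ → UnitAddTorus (Fin 3) → EuclideanSpace ℝ (Fin 3)) (t : ℝ) (r : Space R) :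
    ∑ z : box R, 2 * |(⟪r z, tailVec W₁ n ((1 / (n : ℝ) ^ 2) • 𝔸) F w ℓ R t z⟫_ℂ).re| ≤
      (1 / 4) * (8 * Real.pi ^ 2 * (lo / (n : ℝ) ^ 2) * ∑ z : box R, freqNormSq (classFreq n ℓ z.1) * ‖r z‖ ^ 2) +
        (2 / lo) * tailEnergy W₁ n ℓ 𝔸 R F w t := by
  have hn0 : (0 : ℝ) < n := by exact_mod_cast Nat.pos_of_ne_zero hn
  set ε := 2 * Real.pi ^ 2 * lo / (n : ℝ) ^ 2 with hε
  have hε0 : 0 < ε := by positivity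
  have hk : ∀ z : box R, classFreq n ℓ z.1 ≠ 0 := by
    intro z h0
    have h1 := sqrt_freqNormSq_classFreq_ge_half hℓ z
    rw [h0] at h1
    have hZ1 : 1 ≤ Real.sqrt (freqNormSq z.1) := by
      rw [← Real.sqrt_one]; exact Real.sqrt_le_sqrt (Torus.one_le_freqNormSq_of_ne_zero (ne_zero_of_mem_box z.2))
    have h2 : freqNormSq (0 : Fin 3 → ℤ) = 0 := by simp [freqNormSq]
    rw [h2, Real.sqrt_zero] at h1
    nlinarith
  have hz := fun z : box R => two_abs_re_inner_tail_le W₁ hn ((1 / (n : ℝ) ^ 2) • 𝔸) F w ℓ R t z (hk z) hε0 (r z)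
  refine (Finset.sum_le_sum fun z _ => hz z).trans (le_of_eq ?_)
  rw [Finset.sum_add_distrib, tailEnergy_def, Finset.mul_sum, Finset.mul_sum, Finset.mul_sum]
  congr 1
  · refine Finset.sum_congr rfl fun z _ => ?_
    rw [hε]; field_simp; ring
  · refine Finset.sum_congr rfl fun z _ => ?_
    rw [hε]; field_simp; ring

/-- **The dissipation weight dominates the plain norm**: `(n²/4)·‖r‖² ≤ Σ_z |k_z|²‖r_z‖²` (`2|ℓ| ≤ n`, `z ≠ 0` on the box).
[cite: MajdaKramer1999, §2.2.1.3 (cell problem (49))] -/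
theorem norm_sq_le_dissipation {n : ℕ} {ℓ : Fin 3 → ℤ} (hℓ : 2 * Real.sqrt (freqNormSq ℓ) ≤ n) {R : ℕ} (r : Space R) :
    (n : ℝ) ^ 2 / 4 * ‖r‖ ^ 2 ≤ ∑ z : box R, freqNormSq (classFreq n ℓ z.1) * ‖r z‖ ^ 2 := by
  rw [PiLp.norm_sq_eq_of_L2, Finset.mul_sum]
  refine Finset.sum_le_sum fun z _ => mul_le_mul_of_nonneg_right ?_ (sq_nonneg _)
  have h1 := sqrt_freqNormSq_classFreq_ge_half hℓ z
  have hZ1 : 1 ≤ Real.sqrt (freqNormSq z.1) := by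
    rw [← Real.sqrt_one]; exact Real.sqrt_le_sqrt (Torus.one_le_freqNormSq_of_ne_zero (ne_zero_of_mem_box z.2))
  have hn : (0 : ℝ) ≤ n := Nat.cast_nonneg n
  have h2 : (n : ℝ) / 2 ≤ Real.sqrt (freqNormSq (classFreq n ℓ z.1)) := by nlinarith [mul_le_mul_of_nonneg_left hZ1 hn]
  have h3 : ((n : ℝ) / 2) ^ 2 ≤ Real.sqrt (freqNormSq (classFreq n ℓ z.1)) ^ 2 := pow_le_pow_left₀ (by positivity) h2 2
  rw [Real.sq_sqrt (freqNormSq_nonneg _)] at h3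
  linarith

/-! ## §4 The abstract splitting of `2⟪r, Def⟫` and the scalar bookkeeping -/

/-- **Splitting the defect pairing**: `2⟪r, D₁ + D₂ − D₃ + D₄⟫_ℝ ≤ 2⟪r, D₁⟫_ℝ + 2‖r‖‖D₂‖ + 2‖r‖‖D₃‖ + Σ_z 2|Re⟪r_z, (D₄)_z⟫|`. [folklore] -/
theorem two_real_inner_defect_split {R : ℕ} (r D₁ D₂ D₃ D₄ : Space R) :
    2 * ⟪r, D₁ + D₂ - D₃ + D₄⟫_ℝ ≤
      2 * ⟪r, D₁⟫_ℝ + 2 * (‖r‖ * ‖D₂‖) + 2 * (‖r‖ * ‖D₃‖) + ∑ z : box R, 2 * |(⟪r z, D₄ z⟫_ℂ).re| := by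
  rw [inner_add_right, inner_sub_right, inner_add_right]
  have h2 : ⟪r, D₂⟫_ℝ ≤ ‖r‖ * ‖D₂‖ := real_inner_le_norm _ _
  have h3 : -⟪r, D₃⟫_ℝ ≤ ‖r‖ * ‖D₃‖ := by
    rw [← inner_neg_right]; exact (real_inner_le_norm _ _).trans (by rw [norm_neg])
  have h4 : ⟪r, D₄⟫_ℝ ≤ ∑ z : box R, |(⟪r z, D₄ z⟫_ℂ).re| := by
    rw [real_inner_space_eq_sum]; exact Finset.sum_le_sum fun z _ => le_abs_self _
  rw [← Finset.mul_sum]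
  linarith

set_option maxHeartbeats 400000 in
/-- **Scalar bookkeeping of the four defect groups** (all quantities real), in the exact shapes delivered by the landed bricks:
dissipation `−8π²(lo/n²)·S` with `S ≥ (n²/4)N²`, the D1 group (`¼` dissipation + `Cv ξ²Y² + 4 CL ξ N Y`), the tail group (`¼` dissipation +
`(2/lo)τ`), `d₂ ≤ ξ²C₂X`, `d₃ ≤ ξ CN Xd`, `Xd ≤ 4π²(hi+β/2)ξ²X + ξ Cf Zn`; three Young splits at `θ = π²lo/6`.  [folklore] -/
theorem defect_bookkeeping {φ P P₁ P₄ S N Y X Zn Xd τ ξ lo hi β CL C₂ CN Cf d₂ d₃ : ℝ} {n : ℕ} (hn : n ≠ 0)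
    (hlo : 0 < lo) (hhi : 0 ≤ hi) (hβ : 0 ≤ β) (hτ : 0 ≤ τ) (hξ : 0 ≤ ξ) (hξ1 : ξ ≤ 1) (hCN : 0 ≤ CN)
    (hA : φ ≤ -(8 * Real.pi ^ 2 * (1 / (n : ℝ) ^ 2 * lo)) * S + P)
    (hB : P ≤ P₁ + 2 * (N * d₂) + 2 * (N * d₃) + P₄)
    (hC : P₁ ≤ (1 / 4) * (8 * Real.pi ^ 2 * (lo / (n : ℝ) ^ 2) * S) +
        (32 * Real.pi ^ 2 * 534 ^ 2 * (hi + β / 2) ^ 2 / lo) * ξ ^ 2 * Y ^ 2 + 4 * CL * ξ * (N * Y))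
    (hD : P₄ ≤ (1 / 4) * (8 * Real.pi ^ 2 * (lo / (n : ℝ) ^ 2) * S) + (2 / lo) * τ)
    (hS : (n : ℝ) ^ 2 / 4 * N ^ 2 ≤ S) (hd₂ : 0 ≤ d₂) (hd₃ : 0 ≤ d₃)
    (hd₂b : d₂ ≤ ξ ^ 2 * C₂ * X) (hXd : Xd ≤ 4 * Real.pi ^ 2 * (hi + β / 2) * ξ ^ 2 * X + ξ * Cf * Zn) (hd₃b : d₃ ≤ ξ * CN * Xd) :
    φ ≤ -(Real.pi ^ 2 * lo / 2) * N ^ 2 +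
      (32 * Real.pi ^ 2 * 534 ^ 2 * (hi + β / 2) ^ 2 / lo + 24 * CL ^ 2 / (Real.pi ^ 2 * lo) + 6 * C₂ ^ 2 / (Real.pi ^ 2 * lo) +
          12 * (CN * (4 * Real.pi ^ 2 * (hi + β / 2))) ^ 2 / (Real.pi ^ 2 * lo) + 12 * (CN * Cf) ^ 2 / (Real.pi ^ 2 * lo) + 2 / lo) *
        (ξ ^ 2 * Y ^ 2 + ξ ^ 4 * X ^ 2 + ξ ^ 4 * Zn ^ 2 + τ) := by
  have hn0 : (0 : ℝ) < n := by exact_mod_cast Nat.pos_of_ne_zero hn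
  set σ₀ : ℝ := Real.pi ^ 2 * lo with hσ₀
  set Cv : ℝ := 32 * Real.pi ^ 2 * 534 ^ 2 * (hi + β / 2) ^ 2 / lo with hCv
  set K₄ : ℝ := 4 * Real.pi ^ 2 * (hi + β / 2) with hK₄
  set Dis : ℝ := 8 * Real.pi ^ 2 * (lo / (n : ℝ) ^ 2) * S with hDis_def
  have hσ : 0 < σ₀ := by positivity
  have hθ : 0 < σ₀ / 6 := by positivity
  have hCv0 : 0 ≤ Cv := by positivity
  have hK₄0 : 0 ≤ K₄ := by positivity
  have hA' : φ ≤ -Dis + P := by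
    have e : -(8 * Real.pi ^ 2 * (1 / (n : ℝ) ^ 2 * lo)) * S = -Dis := by rw [hDis_def]; ring
    rw [← e]; exact hA
  have hDis : 2 * σ₀ * N ^ 2 ≤ Dis := by
    have h2 : 8 * Real.pi ^ 2 * (lo / (n : ℝ) ^ 2) * ((n : ℝ) ^ 2 / 4 * N ^ 2) = 2 * σ₀ * N ^ 2 := by
      rw [hσ₀]; field_simp; ring
    rw [← h2, hDis_def]
    exact mul_le_mul_of_nonneg_left hS (by positivity)
  -- the D3 size
  have hd₃b' : d₃ ≤ ξ * CN * (K₄ * ξ ^ 2 * X + ξ * Cf * Zn) :=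
    hd₃b.trans (mul_le_mul_of_nonneg_left hXd (by positivity))
  -- the three Young splits
  have y1 : 4 * CL * ξ * (N * Y) ≤ σ₀ / 6 * N ^ 2 + (2 * CL * ξ * Y) ^ 2 / (σ₀ / 6) := by
    have h := two_mul_le_theta_sq_add (x := N) (y := 2 * CL * ξ * Y) hθ
    linarith only [h]
  have y2 : 2 * (N * d₂) ≤ σ₀ / 6 * N ^ 2 + d₂ ^ 2 / (σ₀ / 6) := two_mul_le_theta_sq_add hθ
  have y3 : 2 * (N * d₃) ≤ σ₀ / 6 * N ^ 2 + d₃ ^ 2 / (σ₀ / 6) := two_mul_le_theta_sq_add hθ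
  -- sizes of the squares
  have hξ6 : ξ ^ 6 ≤ ξ ^ 4 := pow_le_pow_of_le_one hξ hξ1 (by norm_num)
  have s2 : d₂ ^ 2 ≤ C₂ ^ 2 * (ξ ^ 4 * X ^ 2) := by
    calc d₂ ^ 2 ≤ (ξ ^ 2 * C₂ * X) ^ 2 := pow_le_pow_left₀ hd₂ hd₂b 2
      _ = C₂ ^ 2 * (ξ ^ 4 * X ^ 2) := by ring
  have s3 : d₃ ^ 2 ≤ 2 * (CN * K₄) ^ 2 * (ξ ^ 4 * X ^ 2) + 2 * (CN * Cf) ^ 2 * (ξ ^ 4 * Zn ^ 2) := by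
    have h := pow_le_pow_left₀ hd₃ hd₃b' 2
    have hab : (K₄ * ξ ^ 2 * X + ξ * Cf * Zn) ^ 2 ≤ 2 * (K₄ * ξ ^ 2 * X) ^ 2 + 2 * (ξ * Cf * Zn) ^ 2 := by
      have e : 2 * (K₄ * ξ ^ 2 * X) ^ 2 + 2 * (ξ * Cf * Zn) ^ 2 - (K₄ * ξ ^ 2 * X + ξ * Cf * Zn) ^ 2 =
          (K₄ * ξ ^ 2 * X - ξ * Cf * Zn) ^ 2 := by ring
      linarith only [sq_nonneg (K₄ * ξ ^ 2 * X - ξ * Cf * Zn), e]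
    have hexp : (ξ * CN * (K₄ * ξ ^ 2 * X + ξ * Cf * Zn)) ^ 2 ≤
        2 * (CN * K₄) ^ 2 * (ξ ^ 6 * X ^ 2) + 2 * (CN * Cf) ^ 2 * (ξ ^ 4 * Zn ^ 2) := by
      have hc : 0 ≤ (ξ * CN) ^ 2 := sq_nonneg _
      calc (ξ * CN * (K₄ * ξ ^ 2 * X + ξ * Cf * Zn)) ^ 2 = (ξ * CN) ^ 2 * (K₄ * ξ ^ 2 * X + ξ * Cf * Zn) ^ 2 := by ring
        _ ≤ (ξ * CN) ^ 2 * (2 * (K₄ * ξ ^ 2 * X) ^ 2 + 2 * (ξ * Cf * Zn) ^ 2) := mul_le_mul_of_nonneg_left hab hc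
        _ = 2 * (CN * K₄) ^ 2 * (ξ ^ 6 * X ^ 2) + 2 * (CN * Cf) ^ 2 * (ξ ^ 4 * Zn ^ 2) := by ring
    have hm : 2 * (CN * K₄) ^ 2 * (ξ ^ 6 * X ^ 2) ≤ 2 * (CN * K₄) ^ 2 * (ξ ^ 4 * X ^ 2) := by
      have : ξ ^ 6 * X ^ 2 ≤ ξ ^ 4 * X ^ 2 := mul_le_mul_of_nonneg_right hξ6 (sq_nonneg X)
      exact mul_le_mul_of_nonneg_left this (by positivity)
    linarith only [h, hexp, hm]
  have s1 : (2 * CL * ξ * Y) ^ 2 = 4 * CL ^ 2 * (ξ ^ 2 * Y ^ 2) := by ring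
  -- divide the squares by θ
  have q1 : (2 * CL * ξ * Y) ^ 2 / (σ₀ / 6) = 24 * CL ^ 2 / σ₀ * (ξ ^ 2 * Y ^ 2) := by rw [s1]; field_simp; ring
  have q2 : d₂ ^ 2 / (σ₀ / 6) ≤ 6 * C₂ ^ 2 / σ₀ * (ξ ^ 4 * X ^ 2) := by
    rw [div_le_iff₀ hθ]
    calc d₂ ^ 2 ≤ C₂ ^ 2 * (ξ ^ 4 * X ^ 2) := s2
      _ = 6 * C₂ ^ 2 / σ₀ * (ξ ^ 4 * X ^ 2) * (σ₀ / 6) := by field_simp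
  have q3 : d₃ ^ 2 / (σ₀ / 6) ≤ 12 * (CN * K₄) ^ 2 / σ₀ * (ξ ^ 4 * X ^ 2) + 12 * (CN * Cf) ^ 2 / σ₀ * (ξ ^ 4 * Zn ^ 2) := by
    rw [div_le_iff₀ hθ]
    calc d₃ ^ 2 ≤ 2 * (CN * K₄) ^ 2 * (ξ ^ 4 * X ^ 2) + 2 * (CN * Cf) ^ 2 * (ξ ^ 4 * Zn ^ 2) := s3
      _ = (12 * (CN * K₄) ^ 2 / σ₀ * (ξ ^ 4 * X ^ 2) + 12 * (CN * Cf) ^ 2 / σ₀ * (ξ ^ 4 * Zn ^ 2)) * (σ₀ / 6) := by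
          field_simp; ring
  -- every coefficient is dominated by the total constant
  have hmain : φ ≤ -(σ₀ / 2) * N ^ 2 + ((Cv + 24 * CL ^ 2 / σ₀) * (ξ ^ 2 * Y ^ 2) +
      (6 * C₂ ^ 2 / σ₀ + 12 * (CN * K₄) ^ 2 / σ₀) * (ξ ^ 4 * X ^ 2) + 12 * (CN * Cf) ^ 2 / σ₀ * (ξ ^ 4 * Zn ^ 2) + 2 / lo * τ) := by
    have e : (Cv + 24 * CL ^ 2 / σ₀) * (ξ ^ 2 * Y ^ 2) = Cv * ξ ^ 2 * Y ^ 2 + 24 * CL ^ 2 / σ₀ * (ξ ^ 2 * Y ^ 2) := by ring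
    have e' : (6 * C₂ ^ 2 / σ₀ + 12 * (CN * K₄) ^ 2 / σ₀) * (ξ ^ 4 * X ^ 2) =
        6 * C₂ ^ 2 / σ₀ * (ξ ^ 4 * X ^ 2) + 12 * (CN * K₄) ^ 2 / σ₀ * (ξ ^ 4 * X ^ 2) := by ring
    rw [e, e']
    linarith only [y1, y2, y3, q1, q2, q3, hDis, hA', hB, hC, hD]
  have hdom : (Cv + 24 * CL ^ 2 / σ₀) * (ξ ^ 2 * Y ^ 2) +
      (6 * C₂ ^ 2 / σ₀ + 12 * (CN * K₄) ^ 2 / σ₀) * (ξ ^ 4 * X ^ 2) + 12 * (CN * Cf) ^ 2 / σ₀ * (ξ ^ 4 * Zn ^ 2) + 2 / lo * τ ≤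
      (Cv + 24 * CL ^ 2 / σ₀ + 6 * C₂ ^ 2 / σ₀ + 12 * (CN * K₄) ^ 2 / σ₀ + 12 * (CN * Cf) ^ 2 / σ₀ + 2 / lo) *
        (ξ ^ 2 * Y ^ 2 + ξ ^ 4 * X ^ 2 + ξ ^ 4 * Zn ^ 2 + τ) := by
    have hA0 : 0 ≤ ξ ^ 2 * Y ^ 2 := by positivity
    have hB0 : 0 ≤ ξ ^ 4 * X ^ 2 := by positivity
    have hC0 : 0 ≤ ξ ^ 4 * Zn ^ 2 := by positivity
    have hx : 0 ≤ (Cv + 24 * CL ^ 2 / σ₀) * (ξ ^ 4 * X ^ 2 + ξ ^ 4 * Zn ^ 2 + τ) +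
        (6 * C₂ ^ 2 / σ₀ + 12 * (CN * K₄) ^ 2 / σ₀) * (ξ ^ 2 * Y ^ 2 + ξ ^ 4 * Zn ^ 2 + τ) +
        12 * (CN * Cf) ^ 2 / σ₀ * (ξ ^ 2 * Y ^ 2 + ξ ^ 4 * X ^ 2 + τ) + 2 / lo * (ξ ^ 2 * Y ^ 2 + ξ ^ 4 * X ^ 2 + ξ ^ 4 * Zn ^ 2) := by
      positivity
    calc _ ≤ (Cv + 24 * CL ^ 2 / σ₀) * (ξ ^ 2 * Y ^ 2) +
          (6 * C₂ ^ 2 / σ₀ + 12 * (CN * K₄) ^ 2 / σ₀) * (ξ ^ 4 * X ^ 2) + 12 * (CN * Cf) ^ 2 / σ₀ * (ξ ^ 4 * Zn ^ 2) + 2 / lo * τ +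
          ((Cv + 24 * CL ^ 2 / σ₀) * (ξ ^ 4 * X ^ 2 + ξ ^ 4 * Zn ^ 2 + τ) +
            (6 * C₂ ^ 2 / σ₀ + 12 * (CN * K₄) ^ 2 / σ₀) * (ξ ^ 2 * Y ^ 2 + ξ ^ 4 * Zn ^ 2 + τ) +
            12 * (CN * Cf) ^ 2 / σ₀ * (ξ ^ 2 * Y ^ 2 + ξ ^ 4 * X ^ 2 + τ) + 2 / lo * (ξ ^ 2 * Y ^ 2 + ξ ^ 4 * X ^ 2 + ξ ^ 4 * Zn ^ 2)) :=
          le_add_of_nonneg_right hx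
      _ = _ := by ring
  have e : -(σ₀ / 2) * N ^ 2 = -(Real.pi ^ 2 * lo / 2) * N ^ 2 := by rw [hσ₀]
  rw [e] at hmain
  linarith only [hmain, hdom]

/-! ## §5 The energy inequality of the residual -/

set_option maxHeartbeats 400000 in
/-- **THE ENERGY INEQUALITY OF THE RESIDUAL (T4c-3d)**: there is `C = C(W₁, lo, hi, β) ≥ 0` such that for every cell number `n ≥ 1`, tensor
`𝔸` with `NearIso 𝔸 lo hi`, `OddSmall 𝔸 β`, weak solution `w` of the flat tensor cell problem with `𝔹 = (1/n²)•𝔸` and datum `F`, slow mode with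
`2|ℓ| ≤ n`, truncation `R` retaining every `±mⱼ`, and `t ∈ (0,T)`, the right derivative `φ` of `‖r‖²` exists and
`φ ≤ −(π²lo/2)‖r t‖² + C·(ξ²‖y t‖² + ξ⁴‖x t‖² + ξ⁴‖Z t‖² + tailEnergy t)` (`ξ = √|ℓ|²/n`).
[cite: MajdaKramer1999, §2.2.1.3 (cell problem (49))] [cite: SandersVerhulstMurdock2007, Lemma 5.2.7 (linear case)]
[cite: Temam1984, Ch. III §1 Lemma 1.2 (energy inequality)] -/
theorem residualX_energy_ineq (W₁ : LatticeWord k₀) {lo hi β : ℝ} (hlo : 0 < lo) (hhi : 0 ≤ hi) (hβ : 0 ≤ β) :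
    ∃ C : ℝ, 0 ≤ C ∧ ∀ {n : ℕ}, n ≠ 0 → ∀ {𝔸 : Torus.Visc4 (Fin 3)}, Torus.NearIso 𝔸 lo hi → Torus.OddSmall 𝔸 β →
      ∀ {T : ℝ} {F : UnitAddTorus (Fin 3) → EuclideanSpace ℝ (Fin 3)} {w : ℝ → UnitAddTorus (Fin 3) → EuclideanSpace ℝ (Fin 3)},
      Torus.IsWeakTensorPassiveVectorOn 0 T ((1 / (n : ℝ) ^ 2) • 𝔸) (W₁.cell n) F w → Integrable F volume →
      ∀ {ℓ : Fin 3 → ℤ}, 2 * Real.sqrt (freqNormSq ℓ) ≤ n → ∀ {R : ℕ}, (∀ j, (W₁.phase j).m ∈ box R) →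
      ∀ {t : ℝ}, t ∈ Ioo 0 T →
        ∃ φ : ℝ, HasDerivWithinAt (fun τ => ‖residualX W₁ n ℓ 𝔸 R F w τ‖ ^ 2) φ (Ici t) t ∧
          φ ≤ -(Real.pi ^ 2 * lo / 2) * ‖residualX W₁ n ℓ 𝔸 R F w t‖ ^ 2 +
            C * ((Real.sqrt (freqNormSq ℓ) / n) ^ 2 * ‖refState W₁ n ℓ 𝔸 R F w t‖ ^ 2 +
                 (Real.sqrt (freqNormSq ℓ) / n) ^ 4 * ‖modeRep W₁ n ((1 / (n : ℝ) ^ 2) • 𝔸) F w ℓ t‖ ^ 2 +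
                 (Real.sqrt (freqNormSq ℓ) / n) ^ 4 * ‖sbVec W₁ n ((1 / (n : ℝ) ^ 2) • 𝔸) F w ℓ R t‖ ^ 2 +
                 tailEnergy W₁ n ℓ 𝔸 R F w t) := by
  have hmin : 0 < min 1 (4 * Real.pi ^ 2 * lo) := lt_min one_pos (by positivity)
  have hCN0 : 0 ≤ ∑ j, 8 * Real.pi * ‖slotAmp W₁ j‖ / min 1 (4 * Real.pi ^ 2 * lo) := Finset.sum_nonneg fun j _ => by positivity
  refine ⟨32 * Real.pi ^ 2 * 534 ^ 2 * (hi + β / 2) ^ 2 / lo +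
      24 * (∑ j, 2 * Real.pi * ‖slotAmp W₁ j‖ * (5 + 3 * Real.sqrt (freqNormSq (W₁.phase j).m))) ^ 2 / (Real.pi ^ 2 * lo) +
      6 * (∑ j, 4 * Real.pi * ‖slotAmp W₁ j‖ / Real.sqrt (freqNormSq (W₁.phase j).m)) ^ 2 / (Real.pi ^ 2 * lo) +
      12 * ((∑ j, 8 * Real.pi * ‖slotAmp W₁ j‖ / min 1 (4 * Real.pi ^ 2 * lo)) * (4 * Real.pi ^ 2 * (hi + β / 2))) ^ 2 / (Real.pi ^ 2 * lo) +
      12 * ((∑ j, 8 * Real.pi * ‖slotAmp W₁ j‖ / min 1 (4 * Real.pi ^ 2 * lo)) * (∑ j, 4 * Real.pi * ‖slotAmp W₁ j‖)) ^ 2 / (Real.pi ^ 2 * lo) +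
      2 / lo, by positivity, ?_⟩
  intro n hn 𝔸 h𝔸 hodd T F w h hF ℓ hℓ R hbox t ht
  have hT : 0 < T := ht.1.trans ht.2
  have htI : t ∈ Icc 0 T := ⟨ht.1.le, ht.2.le⟩
  have hn0 : (0 : ℝ) < n := by exact_mod_cast Nat.pos_of_ne_zero hn
  have hξ0 : 0 ≤ Real.sqrt (freqNormSq ℓ) / n := by positivity
  have hξ1 : Real.sqrt (freqNormSq ℓ) / n ≤ 1 := by
    rw [div_le_one hn0]; linarith [Real.sqrt_nonneg (freqNormSq ℓ)]
  have h𝔹 : Torus.NearIso ((1 / (n : ℝ) ^ 2) • 𝔸) (1 / (n : ℝ) ^ 2 * lo) (1 / (n : ℝ) ^ 2 * hi) := h𝔸.smul (by positivity)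
  have hN : ∀ j, IsPeriodicResponse W₁ 𝔸 1 R j (response W₁ 𝔸 1 R j) := fun j => isPeriodicResponse_response_of_nearIso W₁ h𝔸 hlo one_pos R j
  have hder := hasDerivWithinAt_residual W₁ n h hF ℓ 1 hbox ht (s := Ici t)
    (fun j => hasDerivWithinAt_responseExt W₁ 𝔸 1 R j (hN j) t)
  rw [← residualX_eq, ← residualX_apply_expanded, ← refState_def] at hder
  refine ⟨_, hasDerivWithinAt_norm_sq_of_genX W₁ n ℓ ((1 / (n : ℝ) ^ 2) • 𝔸) 1 hder, ?_⟩
  have hrT : ∀ z : box R, transversalProj (classFreq n ℓ z.1) (residualX W₁ n ℓ 𝔸 R F w t z) = residualX W₁ n ℓ 𝔸 R F w t z :=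
    fun z => residual_transversal W₁ n hT.le h ℓ R htI _ z
  have hyT : ∀ z : box R, transversalProj z.1 (refState W₁ n ℓ 𝔸 R F w t z) = refState W₁ n ℓ 𝔸 R F w t z :=
    fun z => transversalProj_refState_apply W₁ ℓ h𝔸 hlo R F w t z
  have hxT : kdot ℓ (modeRep W₁ n ((1 / (n : ℝ) ^ 2) • 𝔸) F w ℓ t) = 0 := kdot_modeRep W₁ n hT.le h ℓ htI
  have hA := two_inner_genX_add_le W₁ n ℓ h𝔹 1 t hrT
  have hC := two_real_inner_D1_le W₁ h𝔸 hlo hhi hodd hβ hn hℓ (R := R) 1 1 t hrT hyT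
  have hD := sum_two_abs_re_inner_tail_le W₁ hn hℓ hlo 𝔸 R F w t (residualX W₁ n ℓ 𝔸 R F w t)
  have hS := norm_sq_le_dissipation hℓ (residualX W₁ n ℓ 𝔸 R F w t)
  have hd₂b := norm_sum_smul_sourceX_sub_le W₁ hn ℓ R t (modeRep W₁ n ((1 / (n : ℝ) ^ 2) • 𝔸) F w ℓ t)
  have hXd := norm_slowRHS_le_xi W₁ hn ℓ h𝔸 hlo hhi hodd hβ t hxT (sbVec W₁ n ((1 / (n : ℝ) ^ 2) • 𝔸) F w ℓ R t)
  exact defect_bookkeeping hn hlo hhi hβ (tailEnergy_nonneg W₁ n ℓ 𝔸 R F w t) hξ0 hξ1 hCN0 (hA _)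
    (two_real_inner_defect_split _ _ _ _ _) hC hD hS (norm_nonneg _) (norm_nonneg _) hd₂b hXd
    (norm_projX_sum_smul_responseExt_le W₁ n ℓ h𝔸 hlo R t _)

end Summit.AnomalousDissipation.AnomalousDissipation.Theorems.SolenoidalFractalHomogenisation.LagrangianStep.Sideband

end
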